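import Summits.NavierStokesRegularity.NavierStokesRegularity.Theorems.TaoForcedUniqueness.Negative.SerrinEnstrophyLerayHopf

/-!
# KJ-6 (9/9): `¬ Sohr2001_serrinClass_enstrophyBound_global` and `¬ Sohr2001_serrinClass_enstrophyBound` — the enstrophy of the witness is essentially unbounded near `T/2`

Cell `ns-blowup`, seat `ns-blowup-refuter` (g10 blueprint, g11 kernel), KILLSHEET §XXIV rows KJ-6/KJ-7,
part 9/9 of the kernel certificate `¬ Literature.Analysis.FluidPDE.Sohr2001_serrinClass_enstrophyBound(_global)`
(final file `SohrSerrinEnstrophyCountableJunk.lean` in this directory, which carries the full account and the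
classification). LABEL: refuter construction (explicit data + proved lemmas; no named facts, no `sorry`).
WHAT THIS IS NOT: not Navier–Stokes evidence and not a statement about Sohr's printed theorem — a hygiene
refutation of two facts AS TYPED (slice-wise force class `MemLqLp 2 2`, one outer Bochner integral in the
weak form); nothing here mentions the summit.

THE ACCOUNT. The two named facts `Literature.Analysis.FluidPDE.Sohr2001_serrinClass_enstrophyBound(_global)`
(`ForcedSerrinEnstrophyBound.lean`; Sohr 2001 Thm. V.1.8.1 for `Ω = ℝ³`, first factor of (1.8.2), local resp.
global-in-time form) quantify over forces in the SLICE-WISE class `MemLqLp 2 2 f (Ioo 0 T′)` — NO joint (Bochner)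
measurability of `f` — and over Leray–Hopf solutions (`IsLerayHopfOn`) whose weak identity is ONE outer Bochner
integral in `t` of the slice pairing. WITNESS (refuter4's K54 mechanism, KILLSHEET §XXV, with a TIME-DEPENDENT
feeding direction, §XXIV-F/G): `ν = 1`, `T = 2`, datum `u₀ = 0`, profile `U` = `swirl`,
`u t = t • U_{λ(t)}`, `λ(t)² = 1 + |t − 1|^{-1/4}`, force `f t = κ(t) • U_{λ(t)} + Φ_{λ(t), ℓ(t)}` where `Φ` is the
co-moving junk family (part 3) and `ℓ` labels a SATURATED countable partition of the time axis (every piece meets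
every set of positive measure; `SaturatedPartition.lean`), Serrin pair `(s, q) = (4, 6)`. Every typed hypothesis
holds (`memLp_zero_datum`, `eWeakGradL2Sq_zero_lt_top`, `memLqLp_fW`, `memLqLp_uW`,
`isLerayHopfOn_uW` — the weak form is VOID: no test field is honest against the junk force, part 5), while the
enstrophy `‖∇u(t)‖₂² = t² λ(t)² ‖∇U‖₂²` exceeds every constant on a window `(1 − δ, 1)` of positive measure
(`exists_window_gt`, `not_essBdd_enstrophy`) — inside `(0, 3/2)` for the local form and inside `(0, 2)` for the
global form. CLASSIFICATION: refuted-MISSTATED (as typed). REPAIRED STATEMENT C′ (believed true; it is Sohr's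
theorem up to the Leray–Hopf vs. Sohr-weak solution notion): add the Bochner hypothesis
`(_hfm : AEStronglyMeasurable (uncurry f) ((volume.restrict (Ioo 0 T)).prod volume))` to both facts; the witness
MISSES C′ (its force is not jointly a.e.-strongly measurable — cf. `MemLqLpNonBochnerForce.lean`, KJ-1).
Standard axioms only.
-/

noncomputable section

namespace Summit.NavierStokesRegularity.ForcedUniquenessHygiene.KJ6

open MeasureTheory Set Function Filter Topology Metric
open scoped ENNReal NNReal RealInnerProductSpace ContDiff Laplacian
open Literature.Analysis.FluidPDE Literature.Analysis.FunctionSpaces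

variable {Pr : Profile}

/-! ## §5 The conclusion fails: `t² λ(t)² ‖∇U‖₂²` is essentially unbounded near `T/2` -/

/-- For `C : ℝ≥0` there is `δ ∈ (0, T/4]` such that `‖∇u(t)‖₂² > C` for every `t ∈ (T/2 − δ, T/2)`. -/
theorem exists_window_gt {T : ℝ} (hT : 0 < T) (C : ℝ≥0) :
    ∃ δ : ℝ, 0 < δ ∧ δ ≤ T / 4 ∧ ∀ t ∈ Ioo (T / 2 - δ) (T / 2), (C : ℝ≥0∞) < eWeakGradL2Sq (uW Pr T t) := by
  -- the dissipation constant of the profile as a positive real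
  set E : ℝ≥0∞ := eWeakGradL2Sq Pr.U with hE
  have hEt : E ≠ ⊤ := Pr.grad_lt_top.ne
  have hE0 : 0 < E.toReal := ENNReal.toReal_pos Pr.grad_pos.ne' hEt
  -- the threshold `K` for `|t − T/2|^{-1/4}` and the window
  set K : ℝ := ((C : ℝ) + 1) / ((T / 4) ^ 2 * E.toReal) with hK
  have hK0 : 0 < K := by positivity
  refine ⟨min (T / 4) (K ^ (-(4 : ℝ))), lt_min (by positivity) (Real.rpow_pos_of_pos hK0 _),
    min_le_left _ _, fun t ht => ?_⟩
  obtain ⟨ht1, ht2⟩ := ht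
  have hδ1 : min (T / 4) (K ^ (-(4 : ℝ))) ≤ T / 4 := min_le_left _ _
  have hδ2 : min (T / 4) (K ^ (-(4 : ℝ))) ≤ K ^ (-(4 : ℝ)) := min_le_right _ _
  have htT : t ≠ T / 2 := ht2.ne
  have ht4 : T / 4 < t := by linarith
  have htpos : 0 < t := lt_trans (by positivity) ht4
  have ht0 : t ≠ 0 := htpos.ne'
  -- `|t − T/2|^{-1/4} ≥ K`
  have habs : 0 < |t - T / 2| := abs_pos.2 (sub_ne_zero.2 htT)
  have habs' : |t - T / 2| ≤ K ^ (-(4 : ℝ)) := by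
    rw [abs_sub_comm, abs_of_pos (by linarith)]; linarith
  have hpow : K ≤ |t - T / 2| ^ (-(1 / 4 : ℝ)) := by
    have h1 : (K ^ (-(4 : ℝ))) ^ (-(1 / 4 : ℝ)) ≤ |t - T / 2| ^ (-(1 / 4 : ℝ)) :=
      Real.rpow_le_rpow_of_nonpos habs habs' (by norm_num)
    have h2 : (K ^ (-(4 : ℝ))) ^ (-(1 / 4 : ℝ)) = K := by
      rw [← Real.rpow_mul hK0.le]; norm_num
    rwa [h2] at h1
  have hlam : K ≤ lamSq T t := by unfold lamSq; linarith
  -- the real enstrophy exceeds `C + 1 > C`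
  have hreal : (C : ℝ) < t ^ 2 * lamSq T t * E.toReal := by
    have h1 : (T / 4) ^ 2 ≤ t ^ 2 := by
      have : 0 < T / 4 := by positivity
      nlinarith
    have h2 : (T / 4) ^ 2 * K ≤ t ^ 2 * lamSq T t :=
      mul_le_mul h1 hlam hK0.le (sq_nonneg t)
    have h3 : (T / 4) ^ 2 * K * E.toReal = (C : ℝ) + 1 := by
      rw [hK]; field_simp
    nlinarith [mul_le_mul_of_nonneg_right h2 hE0.le]
  rw [eWeakGradL2Sq_uW Pr htT ht0, ← hE]
  have h4 : ((C : ℝ≥0) : ℝ≥0∞) = ENNReal.ofReal (C : ℝ) := by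
    rw [ENNReal.ofReal_coe_nnreal]
  have hnn : 0 ≤ t ^ 2 * lamSq T t := mul_nonneg (sq_nonneg t) (lamSq_pos T t).le
  have hpos : 0 < t ^ 2 * lamSq T t * E.toReal :=
    mul_pos (mul_pos (pow_pos htpos 2) (lamSq_pos T t)) hE0
  rw [h4, ← ENNReal.ofReal_toReal hEt, ← ENNReal.ofReal_mul hnn]
  exact (ENNReal.ofReal_lt_ofReal_iff hpos).2 hreal

/-- **The conclusion of the fact fails for the witness**: on every `(0, T′)` with `T/2 < T′` the
enstrophy `‖∇u(t)‖₂²` is NOT essentially bounded (it exceeds any `C` on a whole window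
`(T/2 − δ, T/2)` of positive measure). -/
theorem not_essBdd_enstrophy {T : ℝ} (hT : 0 < T) {T' : ℝ} (hT' : T / 2 < T') :
    ¬ ∃ C : ℝ≥0, ∀ᵐ t ∂(volume.restrict (Ioo 0 T')), eWeakGradL2Sq (uW Pr T t) ≤ C := by
  rintro ⟨C, hC⟩
  obtain ⟨δ, hδ, hδT, hwin⟩ := exists_window_gt (Pr := Pr) hT C
  have hC' : ∀ᵐ t ∂volume, t ∈ Ioo 0 T' → eWeakGradL2Sq (uW Pr T t) ≤ C :=
    (ae_restrict_iff' measurableSet_Ioo).mp hC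
  have hsub : Ioo (T / 2 - δ) (T / 2) ⊆ {t | ¬ (t ∈ Ioo 0 T' → eWeakGradL2Sq (uW Pr T t) ≤ C)} := by
    intro t ht
    have ht' : t ∈ Ioo 0 T' := ⟨by linarith [ht.1], by linarith [ht.2]⟩
    exact fun himp => not_le.mpr (hwin t ht) (himp ht')
  have h0 : volume (Ioo (T / 2 - δ) (T / 2)) = 0 := measure_mono_null hsub (ae_iff.mp hC')
  rw [Real.volume_Ioo] at h0
  have : ENNReal.ofReal (T / 2 - (T / 2 - δ)) ≠ 0 := (ENNReal.ofReal_pos.2 (by linarith)).ne'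
  exact this h0

/-! ## §6 The refutations -/

/-- **KJ-6, global form: `Sohr2001_serrinClass_enstrophyBound_global` AS TYPED is false** [refuted-misstated].
Witness `ν = 1`, `T = 2`, datum `0`, `u t = t • U_{λ(t)}`, `f t = κ(t) • U_{λ(t)} + Φ_{λ(t), ℓ(t)}` (saturated label `ℓ`),
Serrin pair `(4, 6)`: all hypotheses hold (`isLerayHopfOn_uW`, `memLqLp_fW`, `memLqLp_uW`) and the enstrophy is not
essentially bounded on `(0, 2)` (`not_essBdd_enstrophy`, window below `T/2 = 1`). Repaired statement C′: add
`(_hfm : AEStronglyMeasurable (uncurry f) ((volume.restrict (Ioo 0 T)).prod volume))`; the witness misses C′. -/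
theorem not_Sohr2001_serrinClass_enstrophyBound_global :
    ¬ Sohr2001_serrinClass_enstrophyBound_global := by
  intro h
  obtain ⟨P, hdisj, hcov, hP⟩ := exists_saturated_partition
  obtain ⟨Pr⟩ := exists_profile
  obtain ⟨J⟩ := exists_junkFamily Pr
  obtain ⟨ℓ, hℓ, hℓ'⟩ := exists_label hdisj hcov
  have hν : (0 : ℝ) < 1 := one_pos
  have hT : (0 : ℝ) < 2 := two_pos
  have := h hν hT memLp_zero_datum (by intro θ _; simp) eWeakGradL2Sq_zero_lt_top
    (memLqLp_fW J hν hT le_rfl) (isLerayHopfOn_uW J hP hℓ hℓ' hν hT)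
    (s := 4) (q := 6) (by norm_num) (by simp) (by norm_num) (by simp) serrin_pair_46
    (memLqLp_uW hT le_rfl)
  exact not_essBdd_enstrophy (T := 2) hT (T' := 2) (by norm_num) this

/-- **KJ-6, printed (local) form: `Sohr2001_serrinClass_enstrophyBound` AS TYPED is false** [refuted-misstated].
Same witness with `T = 2`; the conclusion fails on the sub-interval `(0, T′)`, `T′ = 3/2 > T/2 = 1`
(`not_essBdd_enstrophy`). Repaired statement C′: add the Bochner measurability of `f` on `(0,T) × (EuclideanSpace ℝ (Fin 3))`; the witness
misses C′. -/
theorem not_Sohr2001_serrinClass_enstrophyBound :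
    ¬ Sohr2001_serrinClass_enstrophyBound := by
  intro h
  obtain ⟨P, hdisj, hcov, hP⟩ := exists_saturated_partition
  obtain ⟨Pr⟩ := exists_profile
  obtain ⟨J⟩ := exists_junkFamily Pr
  obtain ⟨ℓ, hℓ, hℓ'⟩ := exists_label hdisj hcov
  have hν : (0 : ℝ) < 1 := one_pos
  have hT : (0 : ℝ) < 2 := two_pos
  have := h hν hT memLp_zero_datum (by intro θ _; simp) eWeakGradL2Sq_zero_lt_top
    (fun T' _ hT'T => memLqLp_fW J hν hT hT'T.le) (isLerayHopfOn_uW J hP hℓ hℓ' hν hT)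
    (s := 4) (q := 6) (by norm_num) (by simp) (by norm_num) (by simp) serrin_pair_46
    (fun T' _ hT'T => memLqLp_uW hT hT'T.le) (3 / 2) (by norm_num) (by norm_num)
  exact not_essBdd_enstrophy (T := 2) hT (T' := 3 / 2) (by norm_num) this

end Summit.NavierStokesRegularity.ForcedUniquenessHygiene.KJ6
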